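import Literature.MathematicalPhysics.KineticTheory.InfiniteChainSuperstableDynamics
import Literature.MathematicalPhysics.KineticTheory.InfiniteChainSpecificationDensity
import HarnessLib

/-!
# The Markov-chain (transfer-operator) state of the chain obeys Buttà–Marchioro's
# superstability estimate (2.3)

Topic `Literature/MathematicalPhysics/KineticTheory`; theorems only (no definitions, no named
facts). Companion of `InfiniteChainSuperstableDynamics.lean` (`bmLocalEnergy` = BM's `W_{μ,k}`,
`HasSuperstabilityEstimate` = BM (2.3)); the window densities
`D a n σ = φ(σ_a) φ(σ_{a+n}) ∏_{j<n} (k L⁻¹) ∏_{j≤n} w` of the two-sided stationary Markov chain of a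
transfer kernel are those of `Literature.Probability.LatticeModels.MarkovWindowDensity` (not imported:
only their algebraic form `hD` is used).

For a chain `P` with `U, V ≥ 0`, `V` even, at temperature `T > 0`, take the transfer data
`w(z) = e^{-(p²/2+U(q))/T}`, `k(z, z') = e^{-V(q'-q)/T}` (so `k ≤ 1`), a bounded eigenfunction
`φ ≤ B` and `L > 0`. If a probability measure `μ` integrates window observables against the
densities `D a n` (the conclusion of `exists_markovChainMeasure`), then `μ` satisfies (2.3):
with `λ₀ = 1/(2T)`, for `0 < λ ≤ λ₀`,

  `μ(e^{λ W_{m,k}}) ≤ B² L^{-2k} M^{2k+1} ≤ e^{C(2k+1)}`,  `M = e^{λ₀} ∫ e^{-(p²/2+U)/(2T)} dq dp`,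

because on the window `{m-k, …, m+k}` one has `W ≤ ∑ (p²/2+U+1) + 2 ∑_{bonds} V` (`V` even),
`e^{2λV} k ≤ 1` and `e^{λ(p²/2+U+1)} w ≤ e^{λ₀} e^{-(p²/2+U)/(2T)}`. This is the standard remark that
transfer-operator states are superstable (Ruelle 1976; Lebowitz–Presutti 1976; BM 2016 §2 cite
[BMPP]); here it is a direct computation with the explicit window densities.

* `sum_Icc_eq_sum_range`, `bmPair_Icc_le`, `bmLocalEnergy_le_window` — `W_{m,k}` on its window;
* `lmarginal_prod_range` — `∫⋯∫⁻ ∏_j g(σ_{a+j}) = (∫ g)^{n+1}`;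
* `lintegral_exp_bmLocalEnergy_le` — the window bound `μ(e^{λW}) ≤ B² L^{-2k} M^{2k+1}`;
* `hasSuperstabilityEstimate_of_windowDensity` — **(2.3)**.

[cite: ButtaMarchioro2016, §2 eq. (2.3)]
-/

noncomputable section

open MeasureTheory Set Function Finset Filter
open scoped ENNReal

namespace Literature.MathematicalPhysics.KineticTheory.HeatConduction

namespace OscillatorChain

variable (P : OscillatorChain)

/-! ### `W_{m,k}` on its window -/

omit P in
/-- Reindexing a sum over the window `{a, …, a+n}` by `j ↦ a + j`, `j ≤ n`. [folklore] -/
theorem sum_Icc_eq_sum_range {M : Type*} [AddCommMonoid M] (f : ℤ → M) (a : ℤ) (n : ℕ) :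
    ∑ i ∈ Finset.Icc a (a + n), f i = ∑ j ∈ Finset.range (n + 1), f (a + j) := by
  refine Finset.sum_nbij' (fun i : ℤ => (i - a).toNat) (fun j : ℕ => a + (j : ℤ)) ?_ ?_ ?_ ?_ ?_
  · intro i hi
    rw [Finset.mem_Icc] at hi
    exact Finset.mem_range.2 (by omega)
  · intro j hj
    rw [Finset.mem_range] at hj
    rw [Finset.mem_Icc]
    omega
  · intro i hi
    rw [Finset.mem_Icc] at hi
    rw [Int.toNat_of_nonneg (by omega)]
    ring
  · intro j _
    simp
  · intro i hi
    rw [Finset.mem_Icc] at hi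
    congr 1
    rw [Int.toNat_of_nonneg (by omega)]
    ring

/-- **The pair part of `W` over a window is twice the sum over the bonds inside the window**
(`V ≥ 0` even): `∑_{i,j ∈ Λ, |i-j|=1} V(q_i - q_j) ≤ 2 ∑_{j<n} V(q_{a+j+1} - q_{a+j})` for
`Λ = {a, …, a+n}`. [folklore] -/
theorem bmPair_Icc_le (hVe : ∀ r, P.V (-r) = P.V r) (a : ℤ) (n : ℕ) (σ : ChainConfig) :
    ∑ i ∈ Finset.Icc a (a + n), ∑ j ∈ Finset.Icc a (a + n),
        (if |j - i| = 1 then P.V ((σ i).1 - (σ j).1) else 0) ≤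
      2 * ∑ j ∈ Finset.range n, P.V ((σ (a + j + 1)).1 - (σ (a + j)).1) := by
  set Λ := Finset.Icc a (a + n) with hΛ
  -- split the indicator `|j - i| = 1` into `j = i + 1` and `j = i - 1`
  have hsplit : ∀ i j : ℤ, (if |j - i| = 1 then P.V ((σ i).1 - (σ j).1) else 0) =
      (if j = i + 1 then P.V ((σ i).1 - (σ j).1) else 0) +
        (if j = i - 1 then P.V ((σ i).1 - (σ j).1) else 0) := by
    intro i j
    by_cases h1 : j = i + 1
    · subst h1
      have hne : i + 1 ≠ i - 1 := by omega
      simp [hne]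
    · by_cases h2 : j = i - 1
      · subst h2
        simp [h1]
      · have hne : |j - i| ≠ 1 := fun habs => by
          rcases (abs_eq (by norm_num : (0 : ℤ) ≤ 1)).1 habs with h | h <;> omega
        simp [h1, h2, hne]
  simp_rw [hsplit, Finset.sum_add_distrib, Finset.sum_ite_eq']
  -- reindex both sums over `j ≤ n`
  rw [sum_Icc_eq_sum_range, sum_Icc_eq_sum_range]
  -- the first sum: the last term vanishes, the others are present
  have h1 : ∑ j ∈ Finset.range (n + 1),
      (if a + (j : ℤ) + 1 ∈ Λ then P.V ((σ (a + j)).1 - (σ (a + j + 1)).1) else 0) =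
      ∑ j ∈ Finset.range n, P.V ((σ (a + j + 1)).1 - (σ (a + j)).1) := by
    rw [Finset.sum_range_succ, if_neg (by simp only [hΛ, Finset.mem_Icc]; omega), add_zero]
    refine Finset.sum_congr rfl fun j hj => ?_
    rw [Finset.mem_range] at hj
    rw [if_pos (by simp only [hΛ, Finset.mem_Icc]; omega), ← hVe, neg_sub]
  -- the second sum: the first term vanishes, the others are present
  have h2 : ∑ j ∈ Finset.range (n + 1),
      (if a + (j : ℤ) - 1 ∈ Λ then P.V ((σ (a + j)).1 - (σ (a + j - 1)).1) else 0) =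
      ∑ j ∈ Finset.range n, P.V ((σ (a + j + 1)).1 - (σ (a + j)).1) := by
    rw [Finset.sum_range_succ', if_neg (by simp only [hΛ, Finset.mem_Icc]; omega), add_zero]
    refine Finset.sum_congr rfl fun j hj => ?_
    rw [Finset.mem_range] at hj
    have e1 : a + ((j + 1 : ℕ) : ℤ) - 1 = a + j := by push_cast; ring
    have e2 : a + ((j + 1 : ℕ) : ℤ) = a + j + 1 := by push_cast; ring
    rw [e1, e2, if_pos (by simp only [hΛ, Finset.mem_Icc]; omega)]
  rw [h1, h2]
  linarith

/-- **`W_{m,k}` bounded by one-site terms and bonds inside its window**: with `a = m - k`,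
`W_{m,k}(σ) ≤ ∑_{j≤2k} (p²/2 + U + 1)(σ_{a+j}) + 2 ∑_{j<2k} V(q_{a+j+1} - q_{a+j})` (`V` even).
[cite: ButtaMarchioro2016, §2 eq. (2.4)] -/
theorem bmLocalEnergy_le_window (hVe : ∀ r, P.V (-r) = P.V r) (m : ℤ) (k : ℕ) (σ : ChainConfig) :
    P.bmLocalEnergy m k σ ≤
      (∑ j ∈ Finset.range (2 * k + 1), ((σ (m - k + j)).2 ^ 2 / 2 + P.U (σ (m - k + j)).1 + 1)) +
        2 * ∑ j ∈ Finset.range (2 * k), P.V ((σ (m - k + j + 1)).1 - (σ (m - k + j)).1) := by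
  unfold bmLocalEnergy
  have hwin : Finset.Icc (m - k) (m + k) = Finset.Icc (m - k) (m - k + ↑(2 * k)) := by
    congr 1; push_cast; ring
  rw [hwin, sum_Icc_eq_sum_range]
  exact add_le_add le_rfl (P.bmPair_Icc_le hVe _ _ σ)

omit P in
/-- `W_{m,k}` depends only on the coordinates in its window (written as `{a, …, a + 2k}`,
`a = m - k`). [folklore] -/
theorem dependsOn_exp_bmLocalEnergy (P : OscillatorChain) (lam : ℝ) (m : ℤ) (k : ℕ) :
    DependsOn (fun σ : ChainConfig => ENNReal.ofReal (Real.exp (lam * P.bmLocalEnergy m k σ)))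
      (↑(Finset.Icc (m - k) (m - k + ↑(2 * k))) : Set ℤ) := by
  intro x y hxy
  have hxy' : ∀ i ∈ Finset.Icc (m - k) (m + k), x i = y i := fun i hi => by
    refine hxy i (Finset.mem_coe.2 ?_)
    simp only [Finset.mem_Icc] at hi ⊢
    push_cast
    omega
  dsimp only
  congr 3
  unfold bmLocalEnergy
  congr 1
  · exact Finset.sum_congr rfl fun i hi => by rw [hxy' i hi]
  · exact Finset.sum_congr rfl fun i hi => Finset.sum_congr rfl fun j hj => by
      rw [hxy' i hi, hxy' j hj]

/-! ### Marginal integral of a product of one-site functions -/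

omit P in
/-- `∫⋯∫⁻_{a,…,a+n} ∏_{j≤n} g(σ_{a+j}) = (∫ g)^{n+1}`. [folklore] -/
theorem lmarginal_prod_range {g : ℝ × ℝ → ℝ≥0∞} (hg : Measurable g) (a : ℤ) (n : ℕ)
    (η : ChainConfig) :
    (∫⋯∫⁻_Finset.Icc a (a + n), (fun σ : ChainConfig => ∏ j ∈ Finset.range (n + 1), g (σ (a + j)))
      ∂fun _ : ℤ => (volume : Measure (ℝ × ℝ))) η =
      (∫⁻ z, g z) ^ (n + 1) := by
  induction n generalizing η with
  | zero =>
    rw [show a + ((0 : ℕ) : ℤ) = a by simp, show Finset.Icc a a = {a} from Finset.Icc_self a,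
      lmarginal_singleton]
    simp
  | succ n ih =>
    have hset : Finset.Icc a (a + ↑(n + 1)) = insert (a + n + 1) (Finset.Icc a (a + n)) := by
      ext i; simp only [Finset.mem_insert, Finset.mem_Icc]; push_cast; omega
    have hnot : a + (n : ℤ) + 1 ∉ Finset.Icc a (a + n) := by
      simp only [Finset.mem_Icc]; omega
    have hmeas : Measurable fun σ : ChainConfig => ∏ j ∈ Finset.range (n + 1 + 1), g (σ (a + j)) :=
      Finset.measurable_prod _ fun j _ => hg.comp (measurable_pi_apply _)
    rw [hset, lmarginal_insert' _ hmeas hnot]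
    have hinner : (fun σ : ChainConfig => ∫⁻ y, ∏ j ∈ Finset.range (n + 1 + 1),
        g ((Function.update σ (a + n + 1) y) (a + j))) =
        fun σ => (∏ j ∈ Finset.range (n + 1), g (σ (a + j))) * ∫⁻ z, g z := by
      funext σ
      have hval : ∀ y, ∏ j ∈ Finset.range (n + 1 + 1), g ((Function.update σ (a + n + 1) y) (a + j)) =
          (∏ j ∈ Finset.range (n + 1), g (σ (a + j))) * g y := by
        intro y
        rw [Finset.prod_range_succ]
        congr 1
        · refine Finset.prod_congr rfl fun j hj => ?_
          rw [Finset.mem_range] at hj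
          rw [Function.update_of_ne (by omega)]
        · rw [show a + ((n + 1 : ℕ) : ℤ) = a + n + 1 by push_cast; ring, Function.update_self]
      simp_rw [hval]
      rw [lintegral_const_mul _ hg]
    have hmeas' : Measurable fun σ : ChainConfig => ∏ j ∈ Finset.range (n + 1), g (σ (a + j)) :=
      Finset.measurable_prod _ fun j _ => hg.comp (measurable_pi_apply _)
    rw [hinner, lmarginal_mul_const _ hmeas', ih, ← pow_succ]

/-! ### The exponential-moment bound on a window -/

/-- **Pointwise bound on the window.** With `w = e^{-(p²/2+U)/T}`, `k = e^{-V(q'-q)/T}`, `φ ≤ B`,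
`U, V ≥ 0`, `V` even, `0 < λ ≤ 1/(2T)`:
`e^{λ W_{m,k}(σ)} D (m-k) (2k) σ ≤ B² (L⁻¹)^{2k} ∏_{j≤2k} g(σ_{m-k+j})`,
`g(z) = e^{1/(2T)} e^{-(p²/2+U(q))/(2T)}`. [cite: ButtaMarchioro2016, §2 eq. (2.3)] -/
theorem exp_bmLocalEnergy_mul_windowDensity_le {T : ℝ} (hT : 0 < T)
    (hU0 : ∀ r, 0 ≤ P.U r) (hV0 : ∀ r, 0 ≤ P.V r) (hVe : ∀ r, P.V (-r) = P.V r)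
    {k : ℝ × ℝ → ℝ × ℝ → ℝ≥0∞} {φ w : ℝ × ℝ → ℝ≥0∞} {L : ℝ≥0∞} {B : ℝ}
    {D : ℤ → ℕ → ChainConfig → ℝ≥0∞}
    (hw : ∀ z, w z = ENNReal.ofReal (Real.exp (-T⁻¹ * (z.2 ^ 2 / 2 + P.U z.1))))
    (hk : ∀ z z', k z z' = ENNReal.ofReal (Real.exp (-T⁻¹ * P.V (z'.1 - z.1))))
    (hφB : ∀ z, φ z ≤ ENNReal.ofReal B)
    (hD : ∀ a n σ, D a n σ = φ (σ a) * φ (σ (a + n)) *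
      (∏ j ∈ Finset.range n, k (σ (a + j)) (σ (a + j + 1)) * L⁻¹) *
      ∏ j ∈ Finset.range (n + 1), w (σ (a + j)))
    {lam : ℝ} (hlam0 : 0 < lam) (hlam : lam ≤ (2 * T)⁻¹) (m : ℤ) (kk : ℕ) (σ : ChainConfig) :
    ENNReal.ofReal (Real.exp (lam * P.bmLocalEnergy m kk σ)) * D (m - kk) (2 * kk) σ ≤
      ENNReal.ofReal B ^ 2 * L⁻¹ ^ (2 * kk) *
        ∏ j ∈ Finset.range (2 * kk + 1), ENNReal.ofReal (Real.exp ((2 * T)⁻¹) *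
          Real.exp (-(2 * T)⁻¹ * ((σ (m - kk + j)).2 ^ 2 / 2 + P.U (σ (m - kk + j)).1))) := by
  -- notation: `a = m - kk`, `n = 2 kk`, site terms `s j`, bond terms `v j`
  set a : ℤ := m - kk with ha
  set n : ℕ := 2 * kk with hn
  set s : ℕ → ℝ := fun j => (σ (a + j)).2 ^ 2 / 2 + P.U (σ (a + j)).1 with hs
  set v : ℕ → ℝ := fun j => P.V ((σ (a + j + 1)).1 - (σ (a + j)).1) with hv
  have hs0 : ∀ j, 0 ≤ s j := fun j => by
    have := hU0 (σ (a + j)).1; rw [hs]; positivity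
  have hv0 : ∀ j, 0 ≤ v j := fun j => hV0 _
  -- Step 1: `W ≤ ∑ (s j + 1) + 2 ∑ v j`
  have hW : P.bmLocalEnergy m kk σ ≤ (∑ j ∈ Finset.range (n + 1), (s j + 1)) +
      2 * ∑ j ∈ Finset.range n, v j := P.bmLocalEnergy_le_window hVe m kk σ
  have hexpW : ENNReal.ofReal (Real.exp (lam * P.bmLocalEnergy m kk σ)) ≤
      (∏ j ∈ Finset.range (n + 1), ENNReal.ofReal (Real.exp (lam * (s j + 1)))) *
        ∏ j ∈ Finset.range n, ENNReal.ofReal (Real.exp (2 * lam * v j)) := by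
    rw [← ENNReal.ofReal_prod_of_nonneg fun j _ => (Real.exp_pos _).le,
      ← ENNReal.ofReal_prod_of_nonneg fun j _ => (Real.exp_pos _).le,
      ← ENNReal.ofReal_mul (Finset.prod_nonneg fun j _ => (Real.exp_pos _).le),
      ← Real.exp_sum, ← Real.exp_sum, ← Real.exp_add]
    refine ENNReal.ofReal_le_ofReal (Real.exp_le_exp.2 ?_)
    rw [← Finset.mul_sum, ← Finset.mul_sum]
    nlinarith [hW, hlam0]
  -- Step 2: the density on the window
  have hDval : D a n σ = φ (σ a) * φ (σ (a + n)) *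
      (∏ j ∈ Finset.range n, ENNReal.ofReal (Real.exp (-T⁻¹ * v j)) * L⁻¹) *
      ∏ j ∈ Finset.range (n + 1), ENNReal.ofReal (Real.exp (-T⁻¹ * s j)) := by
    rw [hD]
    simp only [hk, hw, hs, hv]
  -- Step 3: combine factor by factor
  have hbond : ∀ j, ENNReal.ofReal (Real.exp (2 * lam * v j)) *
      (ENNReal.ofReal (Real.exp (-T⁻¹ * v j)) * L⁻¹) ≤ L⁻¹ := by
    intro j
    rw [← mul_assoc, ← ENNReal.ofReal_mul (Real.exp_pos _).le, ← Real.exp_add]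
    have h1 : Real.exp (2 * lam * v j + -T⁻¹ * v j) ≤ 1 := by
      rw [Real.exp_le_one_iff]
      have h2 : 2 * lam ≤ T⁻¹ := by
        have := mul_le_mul_of_nonneg_left hlam (by norm_num : (0 : ℝ) ≤ 2)
        rwa [mul_inv, ← mul_assoc, mul_inv_cancel₀ (by norm_num : (2 : ℝ) ≠ 0), one_mul] at this
      nlinarith [hv0 j]
    calc ENNReal.ofReal (Real.exp (2 * lam * v j + -T⁻¹ * v j)) * L⁻¹
        ≤ ENNReal.ofReal 1 * L⁻¹ := mul_le_mul' (ENNReal.ofReal_le_ofReal h1) le_rfl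
      _ = L⁻¹ := by rw [ENNReal.ofReal_one, one_mul]
  have hsite : ∀ j, ENNReal.ofReal (Real.exp (lam * (s j + 1))) *
      ENNReal.ofReal (Real.exp (-T⁻¹ * s j)) ≤
      ENNReal.ofReal (Real.exp ((2 * T)⁻¹) * Real.exp (-(2 * T)⁻¹ * s j)) := by
    intro j
    rw [← ENNReal.ofReal_mul (Real.exp_pos _).le, ← Real.exp_add, ← Real.exp_add]
    refine ENNReal.ofReal_le_ofReal (Real.exp_le_exp.2 ?_)
    have hT2 : (2 * T)⁻¹ + (2 * T)⁻¹ = T⁻¹ := by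
      field_simp; ring
    nlinarith [hs0 j, hlam, hT2, inv_pos.2 hT]
  -- assemble
  calc ENNReal.ofReal (Real.exp (lam * P.bmLocalEnergy m kk σ)) * D a n σ
      ≤ ((∏ j ∈ Finset.range (n + 1), ENNReal.ofReal (Real.exp (lam * (s j + 1)))) *
          ∏ j ∈ Finset.range n, ENNReal.ofReal (Real.exp (2 * lam * v j))) * D a n σ :=
        mul_le_mul' hexpW le_rfl
    _ = φ (σ a) * φ (σ (a + n)) *
        (∏ j ∈ Finset.range n, ENNReal.ofReal (Real.exp (2 * lam * v j)) *
          (ENNReal.ofReal (Real.exp (-T⁻¹ * v j)) * L⁻¹)) *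
        ∏ j ∈ Finset.range (n + 1), ENNReal.ofReal (Real.exp (lam * (s j + 1))) *
          ENNReal.ofReal (Real.exp (-T⁻¹ * s j)) := by
        rw [hDval]
        simp only [Finset.prod_mul_distrib]
        ring
    _ ≤ ENNReal.ofReal B * ENNReal.ofReal B * (∏ _j ∈ Finset.range n, L⁻¹) *
        ∏ j ∈ Finset.range (n + 1), ENNReal.ofReal (Real.exp ((2 * T)⁻¹) *
          Real.exp (-(2 * T)⁻¹ * s j)) := by
        gcongr with j _ j _
        · exact hφB _
        · exact hφB _
        · exact hbond j
        · exact hsite j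
    _ = _ := by
        rw [Finset.prod_const, Finset.card_range, sq]

/-- **The window bound on the exponential moment.** Under the window formula for `μ`,
`μ(e^{λ W_{m,k}}) ≤ B² (L⁻¹)^{2k} M^{2k+1}`, `M = ∫ e^{1/(2T)} e^{-(p²/2+U)/(2T)} dq dp`, for
`0 < λ ≤ 1/(2T)`. [cite: ButtaMarchioro2016, §2 eq. (2.3)] -/
theorem lintegral_exp_bmLocalEnergy_le (hUm : Measurable P.U) (hVm : Measurable P.V) {T : ℝ}
    (hT : 0 < T)
    (hU0 : ∀ r, 0 ≤ P.U r) (hV0 : ∀ r, 0 ≤ P.V r) (hVe : ∀ r, P.V (-r) = P.V r)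
    {k : ℝ × ℝ → ℝ × ℝ → ℝ≥0∞} {φ w : ℝ × ℝ → ℝ≥0∞} {L : ℝ≥0∞} {B : ℝ}
    {D : ℤ → ℕ → ChainConfig → ℝ≥0∞}
    (hw : ∀ z, w z = ENNReal.ofReal (Real.exp (-T⁻¹ * (z.2 ^ 2 / 2 + P.U z.1))))
    (hk : ∀ z z', k z z' = ENNReal.ofReal (Real.exp (-T⁻¹ * P.V (z'.1 - z.1))))
    (hφB : ∀ z, φ z ≤ ENNReal.ofReal B)
    (hD : ∀ a n σ, D a n σ = φ (σ a) * φ (σ (a + n)) *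
      (∏ j ∈ Finset.range n, k (σ (a + j)) (σ (a + j + 1)) * L⁻¹) *
      ∏ j ∈ Finset.range (n + 1), w (σ (a + j)))
    {μ : Measure ChainConfig}
    (hμ : ∀ (a : ℤ) (n : ℕ) (Φ : ChainConfig → ℝ≥0∞), Measurable Φ →
      DependsOn Φ (↑(Finset.Icc a (a + n)) : Set ℤ) → ∀ η : ChainConfig,
        ∫⁻ σ, Φ σ ∂μ = (∫⋯∫⁻_Finset.Icc a (a + n), (fun σ => Φ σ * D a n σ)
          ∂fun _ : ℤ => (volume : Measure (ℝ × ℝ))) η)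
    {lam : ℝ} (hlam0 : 0 < lam) (hlam : lam ≤ (2 * T)⁻¹) (m : ℤ) (kk : ℕ) :
    ∫⁻ σ, ENNReal.ofReal (Real.exp (lam * P.bmLocalEnergy m kk σ)) ∂μ ≤
      ENNReal.ofReal B ^ 2 * L⁻¹ ^ (2 * kk) *
        (∫⁻ z : ℝ × ℝ, ENNReal.ofReal (Real.exp ((2 * T)⁻¹) *
          Real.exp (-(2 * T)⁻¹ * (z.2 ^ 2 / 2 + P.U z.1)))) ^ (2 * kk + 1) := by
  set g : ℝ × ℝ → ℝ≥0∞ := fun z => ENNReal.ofReal (Real.exp ((2 * T)⁻¹) *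
    Real.exp (-(2 * T)⁻¹ * (z.2 ^ 2 / 2 + P.U z.1))) with hg
  have hgm : Measurable g := by
    have : Measurable fun z : ℝ × ℝ => Real.exp ((2 * T)⁻¹) *
        Real.exp (-(2 * T)⁻¹ * (z.2 ^ 2 / 2 + P.U z.1)) :=
      measurable_const.mul (Real.measurable_exp.comp
        ((((measurable_snd.pow_const 2).div_const 2).add (hUm.comp measurable_fst)).const_mul _))
    exact ENNReal.measurable_ofReal.comp this
  have hΦm : Measurable fun σ : ChainConfig => ENNReal.ofReal (Real.exp (lam * P.bmLocalEnergy m kk σ)) :=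
    ENNReal.measurable_ofReal.comp (Real.measurable_exp.comp
      ((P.measurable_bmLocalEnergy hUm hVm m kk).const_mul lam))
  rw [hμ (m - kk) (2 * kk) _ hΦm (dependsOn_exp_bmLocalEnergy P lam m kk) (fun _ => (0, 0))]
  calc (∫⋯∫⁻_Finset.Icc (m - ↑kk) (m - ↑kk + ↑(2 * kk)),
        (fun σ => ENNReal.ofReal (Real.exp (lam * P.bmLocalEnergy m kk σ)) * D (m - ↑kk) (2 * kk) σ)
        ∂fun _ : ℤ => (volume : Measure (ℝ × ℝ))) (fun _ => (0, 0))
      ≤ (∫⋯∫⁻_Finset.Icc (m - ↑kk) (m - ↑kk + ↑(2 * kk)),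
          (fun σ => (∏ j ∈ Finset.range (2 * kk + 1), g (σ (m - kk + j))) *
            (ENNReal.ofReal B ^ 2 * L⁻¹ ^ (2 * kk)))
          ∂fun _ : ℤ => (volume : Measure (ℝ × ℝ))) (fun _ => (0, 0)) := by
        refine lmarginal_mono (fun σ => ?_) _
        rw [mul_comm (∏ j ∈ Finset.range (2 * kk + 1), g (σ (m - kk + j)))]
        exact P.exp_bmLocalEnergy_mul_windowDensity_le hT hU0 hV0 hVe hw hk hφB hD hlam0 hlam m kk σ
    _ = (∫⁻ z, g z) ^ (2 * kk + 1) * (ENNReal.ofReal B ^ 2 * L⁻¹ ^ (2 * kk)) := by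
        have hprodm : Measurable fun σ : ChainConfig =>
            ∏ j ∈ Finset.range (2 * kk + 1), g (σ (m - kk + j)) :=
          Finset.measurable_prod _ fun j _ => hgm.comp (measurable_pi_apply _)
        rw [lmarginal_mul_const _ hprodm, lmarginal_prod_range hgm]
    _ = _ := by rw [mul_comm]

/-! ### The superstability estimate (2.3) -/

omit P in
/-- Arithmetic: `c₁ c₂^{2k} c₃^{2k+1} ≤ e^{C(2k+1)}` with `C = log(max-product) + 1` when the three
constants are finite. [folklore] -/
theorem pow_bound_le_exp {c₁ c₂ c₃ : ℝ≥0∞} (h₁ : c₁ ≠ ∞) (h₂ : c₂ ≠ ∞) (h₃ : c₃ ≠ ∞) :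
    ∃ C : ℝ, 0 < C ∧ ∀ kk : ℕ, c₁ * c₂ ^ (2 * kk) * c₃ ^ (2 * kk + 1) ≤
      ENNReal.ofReal (Real.exp (C * (2 * (kk : ℝ) + 1))) := by
  set c : ℝ≥0∞ := max 1 c₁ * max 1 c₂ * max 1 c₃ with hc
  have hct : c ≠ ∞ := ENNReal.mul_ne_top (ENNReal.mul_ne_top (max_ne_top ENNReal.one_ne_top h₁)
    (max_ne_top ENNReal.one_ne_top h₂)) (max_ne_top ENNReal.one_ne_top h₃)
  have hc1 : 1 ≤ c := by
    rw [hc]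
    calc (1 : ℝ≥0∞) = 1 * 1 * 1 := by ring
      _ ≤ max 1 c₁ * max 1 c₂ * max 1 c₃ := by
        gcongr <;> exact le_max_left _ _
  have hcr1 : 1 ≤ c.toReal := by
    rw [← ENNReal.toReal_one]
    exact (ENNReal.toReal_le_toReal ENNReal.one_ne_top hct).2 hc1
  refine ⟨Real.log c.toReal + 1, by have := Real.log_nonneg hcr1; linarith, fun kk => ?_⟩
  have hle : c₁ * c₂ ^ (2 * kk) * c₃ ^ (2 * kk + 1) ≤ c ^ (2 * kk + 1) := by
    have e1 : c₁ ≤ max 1 c₁ ^ (2 * kk + 1) :=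
      (le_max_right _ _).trans (le_self_pow₀ (le_max_left _ _) (by omega))
    have e2 : c₂ ^ (2 * kk) ≤ max 1 c₂ ^ (2 * kk + 1) :=
      (pow_le_pow_left' (le_max_right _ _) _).trans (pow_le_pow_right₀ (le_max_left _ _) (by omega))
    have e3 : c₃ ^ (2 * kk + 1) ≤ max 1 c₃ ^ (2 * kk + 1) := pow_le_pow_left' (le_max_right _ _) _
    calc c₁ * c₂ ^ (2 * kk) * c₃ ^ (2 * kk + 1)
        ≤ max 1 c₁ ^ (2 * kk + 1) * max 1 c₂ ^ (2 * kk + 1) * max 1 c₃ ^ (2 * kk + 1) := by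
          gcongr
      _ = c ^ (2 * kk + 1) := by rw [hc, mul_pow, mul_pow]
  refine hle.trans ?_
  have hcr0 : 0 < c.toReal := by linarith
  have hcpow : c ^ (2 * kk + 1) = ENNReal.ofReal (c.toReal ^ (2 * kk + 1)) := by
    rw [ENNReal.ofReal_pow hcr0.le, ENNReal.ofReal_toReal hct]
  rw [hcpow]
  refine ENNReal.ofReal_le_ofReal ?_
  have hk0 : (0 : ℝ) ≤ 2 * kk + 1 := by positivity
  have hlog : 0 ≤ Real.log c.toReal := Real.log_nonneg hcr1
  calc c.toReal ^ (2 * kk + 1) = Real.exp (Real.log c.toReal) ^ (2 * kk + 1) := by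
        rw [Real.exp_log hcr0]
    _ = Real.exp (((2 * kk + 1 : ℕ) : ℝ) * Real.log c.toReal) := (Real.exp_nat_mul _ _).symm
    _ ≤ Real.exp ((Real.log c.toReal + 1) * (2 * (kk : ℝ) + 1)) :=
        Real.exp_le_exp.2 (by push_cast; nlinarith)

/-- **The Markov-chain state obeys Buttà–Marchioro's superstability estimate (2.3).** Let `T > 0`,
`U` measurable with `U ≥ 0` and `∫ e^{-U/(2T)} dq < ∞`, `V ≥ 0` even; transfer data
`w = e^{-(p²/2+U)/T}`, `k = e^{-V(q'-q)/T}`, `φ ≤ B`, `0 < L < ∞`; and let the probability measure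
`μ` integrate window observables against the window densities `D a n`. Then
`P.HasSuperstabilityEstimate μ` (with `λ₀ = 1/(2T)`). [cite: ButtaMarchioro2016, §2 eq. (2.3)] -/
theorem hasSuperstabilityEstimate_of_windowDensity (hUm : Measurable P.U) (hVm : Measurable P.V)
    {T : ℝ} (hT : 0 < T)
    (hU0 : ∀ r, 0 ≤ P.U r) (hV0 : ∀ r, 0 ≤ P.V r) (hVe : ∀ r, P.V (-r) = P.V r)
    (hUi2 : Integrable (fun q : ℝ => Real.exp (-(2 * T)⁻¹ * P.U q)))
    {k : ℝ × ℝ → ℝ × ℝ → ℝ≥0∞} {φ w : ℝ × ℝ → ℝ≥0∞} {L : ℝ≥0∞} {B : ℝ}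
    {D : ℤ → ℕ → ChainConfig → ℝ≥0∞}
    (hw : ∀ z, w z = ENNReal.ofReal (Real.exp (-T⁻¹ * (z.2 ^ 2 / 2 + P.U z.1))))
    (hk : ∀ z z', k z z' = ENNReal.ofReal (Real.exp (-T⁻¹ * P.V (z'.1 - z.1))))
    (hφB : ∀ z, φ z ≤ ENNReal.ofReal B) (hL0 : L ≠ 0)
    (hD : ∀ a n σ, D a n σ = φ (σ a) * φ (σ (a + n)) *
      (∏ j ∈ Finset.range n, k (σ (a + j)) (σ (a + j + 1)) * L⁻¹) *
      ∏ j ∈ Finset.range (n + 1), w (σ (a + j)))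
    {μ : Measure ChainConfig} [IsProbabilityMeasure μ]
    (hμ : ∀ (a : ℤ) (n : ℕ) (Φ : ChainConfig → ℝ≥0∞), Measurable Φ →
      DependsOn Φ (↑(Finset.Icc a (a + n)) : Set ℤ) → ∀ η : ChainConfig,
        ∫⁻ σ, Φ σ ∂μ = (∫⋯∫⁻_Finset.Icc a (a + n), (fun σ => Φ σ * D a n σ)
          ∂fun _ : ℤ => (volume : Measure (ℝ × ℝ))) η) :
    P.HasSuperstabilityEstimate μ := by
  -- the one-site integral `M` is finite
  have h2T : 0 < 2 * T := by positivity
  have hM : ∫⁻ z : ℝ × ℝ, ENNReal.ofReal (Real.exp ((2 * T)⁻¹) *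
      Real.exp (-(2 * T)⁻¹ * (z.2 ^ 2 / 2 + P.U z.1))) ≠ ∞ := by
    have hint : Integrable (fun z : ℝ × ℝ => Real.exp ((2 * T)⁻¹) *
        Real.exp (-(2 * T)⁻¹ * (z.2 ^ 2 / 2 + P.U z.1))) :=
      (P.integrable_siteWeight h2T hUi2).const_mul _
    exact ((hasFiniteIntegral_iff_ofReal (Eventually.of_forall fun z => by positivity)).1
      hint.hasFiniteIntegral).ne
  obtain ⟨C, hC, hbound⟩ := pow_bound_le_exp (c₁ := ENNReal.ofReal B ^ 2) (c₂ := L⁻¹)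
    (ENNReal.pow_ne_top ENNReal.ofReal_ne_top) (ENNReal.inv_ne_top.2 hL0) hM
  refine ⟨inferInstance, C, (2 * T)⁻¹, hC, inv_pos.2 h2T, fun lam hlam0 hlam m kk => ?_⟩
  exact (P.lintegral_exp_bmLocalEnergy_le hUm hVm hT hU0 hV0 hVe hw hk hφB hD hμ hlam0 hlam m kk).trans
    (hbound kk)

end OscillatorChain

end Literature.MathematicalPhysics.KineticTheory.HeatConduction

end
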